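import Summits.ValiantsHypothesis.ValiantsHypothesis.Theorems.LacunarySymmetroidMatrixDescartesCensusEndWindow

/-!
# `MatrixDescartes` census — the END-WINDOW row at the HIGH end (mirror form)

HONEST FRAMING.  Object-search cell `pub-symmetroid`, door-A item `Theses.LacunarySymmetroid.DoorA26 = PosRootLawAt 2 6 19`
(stmt-ValiantsHypothesis-19979; OPEN, typed, never asserted).  `…CensusEndWindow.lean` proves the end-window row with a set of LOW
exponents untwisted; this file is the MIRROR statement with a set `H` of HIGH exponents untwisted and the window `r < q < p` below `H`,
obtained by applying `end_window_coeff` to the reflected polynomial `reflect N f` (`N = natDegree f`): coefficients are read backwards,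
positive roots invert (so Descartes-sharpness is preserved), gap products `∏ (s − u)` turn into `∏ (u − s)`.

* `card_posRoots_le_card_posRoots_reflect` — `x ↦ x⁻¹` maps the positive roots of `f` into those of `reflect N f`.
* `end_window_coeff_rev` — f real with `#supp f ≤ #Z₊(f) + 1`, `H ⊆ supp f`, `r < q < p` in `supp f` with every `h ∈ H` above `p`,
  `U = supp f ∖ (H ∪ {p,q,r})`, `C_s = coeff f s · ∏_{u∈U}(u − s)`, `κ_s = ∏_{h∈H}(h − s)`, `a = p − q`, `b = q − r`: if `C_p C_q < 0`,
  `C_q C_r < 0` and weights `w_h ≥ 0` (`∑ w_h ≤ 1`) satisfy `|C_h|^b ((a+b)|C_r| κ_r)^{h−p} ≤ w_h^b |C_p|^b (a|C_q| κ_q)^{h−p}`, then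
  `(a+b)^{a+b} ((1 − ∑ w_h)|C_p|)^b |C_r|^a ≤ |C_q|^{a+b} a^a b^b`.
* `end_window_det_pencil_rev` — the same for `det` of a census pencil.

Nothing here bears on `ζ_sym`, on `DoorA26`/`DoorA34` (OPEN), on the crux `MatrixDescartes` (stmt-ValiantsHypothesis-18050) or on `VP ≠ VNP`.

[folklore] Reflection `X^N f(1/X)` of a polynomial; elementary.
-/

-- `Summit.ValiantsHypothesis.ValiantsHypothesis.…` repeats a component by the D-0017 layout
-- (single-conjunct summit), which the `dupNamespace` linter flags; the name is mandated.
set_option linter.dupNamespace false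

namespace Summit.ValiantsHypothesis.ValiantsHypothesis.Theorems.LacunarySymmetroidMatrixDescartes.Census

open Polynomial Finset
open scoped BigOperators Polynomial

/-- Reflection does not lose positive roots: `x ↦ x⁻¹` maps the positive roots of `f` into those of `reflect N f`
(`N ≥ natDegree f`). [folklore] -/
theorem card_posRoots_le_card_posRoots_reflect (f : ℝ[X]) (hf : f ≠ 0) {N : ℕ} (hN : f.natDegree ≤ N) :
    (f.roots.toFinset.filter (fun x => 0 < x)).card ≤
      ((reflect N f).roots.toFinset.filter (fun x => 0 < x)).card := by
  have hg : reflect N f ≠ 0 := fun h => hf (reflect_eq_zero_iff.mp h)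
  refine Finset.card_le_card_of_injOn (fun x => x⁻¹) (fun x hx => ?_) (fun x _ y _ hxy => inv_injective hxy)
  simp only [Finset.coe_filter, Set.mem_setOf_eq, Multiset.mem_toFinset, mem_roots hf, mem_roots hg, IsRoot.def] at hx ⊢
  obtain ⟨hfx, hx0⟩ := hx
  refine ⟨?_, inv_pos.mpr hx0⟩
  haveI : Invertible x := invertibleOfNonzero hx0.ne'
  have h := (eval₂_reflect_eq_zero_iff (RingHom.id ℝ) x N f hN).mpr (by rw [eval₂_id]; exact hfx)
  rwa [eval₂_id, invOf_eq_inv] at h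

/-- **THE END-WINDOW ROW, HIGH END** (mirror form of `end_window_coeff`; see the module docstring). [folklore] -/
theorem end_window_coeff_rev (f : ℝ[X])
    (hZ : f.support.card ≤ (f.roots.toFinset.filter (fun x => 0 < x)).card + 1)
    (H : Finset ℕ) {p q r : ℕ} (hp : p ∈ f.support) (hq : q ∈ f.support) (hr : r ∈ f.support)
    (hqp : q < p) (hrq : r < q) (hH : H ⊆ f.support) (hHp : ∀ h ∈ H, p < h)
    (U : Finset ℕ) (hU : U = (((f.support \ H).erase p).erase q).erase r)
    (Cf : ℕ → ℝ) (hCf : ∀ s, Cf s = f.coeff s * ∏ u ∈ U, ((u : ℝ) - s))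
    (hspq : Cf p * Cf q < 0) (hsqr : Cf q * Cf r < 0)
    (w : ℕ → ℝ) (hw0 : ∀ h ∈ H, 0 ≤ w h) (hw1 : ∑ h ∈ H, w h ≤ 1)
    (hwl : ∀ h ∈ H, |Cf h| ^ (q - r) * ((((p : ℝ) - r)) * |Cf r| * ∏ i ∈ H, ((i : ℝ) - r)) ^ (h - p)
        ≤ (w h) ^ (q - r) * |Cf p| ^ (q - r) * ((((p : ℝ) - q)) * |Cf q| * ∏ i ∈ H, ((i : ℝ) - q)) ^ (h - p)) :
    (((p : ℝ) - r)) ^ (p - r) * ((1 - ∑ h ∈ H, w h) * |Cf p|) ^ (q - r) * |Cf r| ^ (p - q)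
      ≤ |Cf q| ^ (p - r) * (((p : ℝ) - q)) ^ (p - q) * (((q : ℝ) - r)) ^ (q - r) := by
  classical
  set N := f.natDegree with hN
  have hsN : ∀ s ∈ f.support, s ≤ N := fun s hs => le_natDegree_of_mem_supp s hs
  have hf0 : f ≠ 0 := fun h => by rw [h, support_zero] at hp; simp at hp
  set g : ℝ[X] := reflect N f with hg
  set ρ : ℕ → ℕ := fun s => revAt N s with hρ
  have hρinj : Function.Injective ρ := (revAt N).injective
  have hρρ : ∀ s, ρ (ρ s) = s := fun s => revAt_invol
  have hρle : ∀ s, s ≤ N → ρ s = N - s := fun s hs => revAt_le hs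
  have hgsupp : g.support = f.support.image ρ := reflect_support N f
  have hgcoeff : ∀ s, g.coeff s = f.coeff (ρ s) := fun s => coeff_reflect N f s
  -- sharpness of `g`
  have hgZ : g.support.card ≤ (g.roots.toFinset.filter (fun x => 0 < x)).card + 1 := by
    rw [hgsupp, Finset.card_image_of_injective _ hρinj]
    have h := card_posRoots_le_card_posRoots_reflect f hf0 (le_refl N)
    exact hZ.trans (Nat.add_le_add_right h 1)
  -- the reflected data
  have hUsub : U ⊆ f.support := by
    intro u hu; rw [hU] at hu
    simp only [Finset.mem_erase, Finset.mem_sdiff] at hu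
    exact hu.2.2.2.1
  have hmem : ∀ {s}, s ∈ f.support → ρ s ∈ g.support := fun hs => by
    rw [hgsupp]; exact Finset.mem_image_of_mem _ hs
  have hpN := hsN p hp
  have hqN := hsN q hq
  have hrN := hsN r hr
  have hpq' : ρ p < ρ q := by rw [hρle p hpN, hρle q hqN]; omega
  have hqr' : ρ q < ρ r := by rw [hρle q hqN, hρle r hrN]; omega
  have hL' : H.image ρ ⊆ g.support := by rw [hgsupp]; exact Finset.image_subset_image hH
  have hLp' : ∀ l ∈ H.image ρ, l < ρ p := by
    intro l hl
    obtain ⟨h, hh, rfl⟩ := Finset.mem_image.mp hl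
    rw [hρle h (hsN h (hH hh)), hρle p hpN]
    have := hHp h hh; have := hsN h (hH hh); omega
  have hU' : U.image ρ = (((g.support \ H.image ρ).erase (ρ p)).erase (ρ q)).erase (ρ r) := by
    rw [hU, Finset.image_erase hρinj, Finset.image_erase hρinj, Finset.image_erase hρinj,
      Finset.image_sdiff _ _ hρinj, hgsupp]
  -- cast identities for reflected exponents
  have hcast : ∀ s u, s ≤ N → u ≤ N → ((ρ s : ℕ) : ℝ) - ((ρ u : ℕ) : ℝ) = (u : ℝ) - s := by
    intro s u hs hu
    rw [hρle s hs, hρle u hu, Nat.cast_sub hs, Nat.cast_sub hu]; ring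
  -- the twisted coefficients of `g` are those of `f`
  have hCf' : ∀ s, Cf (ρ s) = g.coeff s * ∏ u ∈ U.image ρ, ((s : ℝ) - u) := by
    intro s
    rw [hgcoeff, Finset.prod_image hρinj.injOn, hCf]
    by_cases hs : ρ s ∈ f.support
    · have hsN' : ρ s ≤ N := hsN _ hs
      congr 1
      refine Finset.prod_congr rfl fun u hu => ?_
      have huN : u ≤ N := hsN u (hUsub hu)
      have h1 : ((u : ℕ) : ℝ) - ((ρ s : ℕ) : ℝ) = ((ρ (ρ s) : ℕ) : ℝ) - ((ρ u : ℕ) : ℝ) := by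
        rw [hcast (ρ s) u hsN' huN]
      rw [h1, hρρ]
    · rw [notMem_support_iff.mp hs, zero_mul, zero_mul]
  have hκ : ∀ s, s ∈ f.support → ∏ i ∈ H.image ρ, (((ρ s : ℕ) : ℝ) - i) = ∏ i ∈ H, ((i : ℝ) - s) := by
    intro s hs
    rw [Finset.prod_image hρinj.injOn]
    refine Finset.prod_congr rfl fun i hi => ?_
    exact hcast s i (hsN s hs) (hsN i (hH hi))
  -- exponent bookkeeping
  have e1 : ρ r - ρ q = q - r := by rw [hρle r hrN, hρle q hqN]; omega
  have e2 : ρ q - ρ p = p - q := by rw [hρle q hqN, hρle p hpN]; omega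
  have e3 : ρ r - ρ p = p - r := by rw [hρle r hrN, hρle p hpN]; omega
  have c1 : ((ρ r : ℕ) : ℝ) - ((ρ p : ℕ) : ℝ) = (p : ℝ) - r := hcast r p hrN hpN
  have c2 : ((ρ q : ℕ) : ℝ) - ((ρ p : ℕ) : ℝ) = (p : ℝ) - q := hcast q p hqN hpN
  have c3 : ((ρ r : ℕ) : ℝ) - ((ρ q : ℕ) : ℝ) = (q : ℝ) - r := hcast r q hrN hqN
  -- apply the low-end theorem to `g` with weights `w ∘ ρ`
  have main := end_window_coeff g hgZ (H.image ρ) (hmem hp) (hmem hq) (hmem hr) hpq' hqr' hL' hLp'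
    (U.image ρ) hU' (fun s => Cf (ρ s)) hCf'
    (by rw [hρρ, hρρ]; exact hspq) (by rw [hρρ, hρρ]; exact hsqr) (fun l => w (ρ l))
    (fun l hl => by obtain ⟨h, hh, rfl⟩ := Finset.mem_image.mp hl; rw [hρρ]; exact hw0 h hh)
    (by rw [Finset.sum_image hρinj.injOn]; simp only [hρρ]; exact hw1)
    (by
      intro l hl
      obtain ⟨h, hh, rfl⟩ := Finset.mem_image.mp hl
      have hhN := hsN h (hH hh)
      have e4 : ρ p - ρ h = h - p := by rw [hρle p hpN, hρle h hhN]; omega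
      rw [hρρ, hρρ, hρρ, hρρ, e1, e4, c1, c2, hκ r hr, hκ q hq]
      exact hwl h hh)
  rw [hρρ, hρρ, hρρ, e1, e2, e3, c1, c2, c3, Finset.sum_image hρinj.injOn] at main
  simp only [hρρ] at main
  exact main

/-- **The high-end end-window row for census pencils.** [folklore] -/
theorem end_window_det_pencil_rev {K m : ℕ} (d : Fin K → ℕ) (S : Fin K → Matrix (Fin m) (Fin m) ℝ)
    (hZ : ((Finset.univ : Finset (Fin m → Fin K)).image (fun g => ∑ i, d (g i))).card ≤
      ((Matrix.det (∑ l, ((X : ℝ[X]) ^ d l) • (S l).map C)).roots.toFinset.filter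
        (fun t => 0 < t)).card + 1)
    (H : Finset ℕ) {p q r : ℕ}
    (hp : p ∈ (Matrix.det (∑ l, ((X : ℝ[X]) ^ d l) • (S l).map C)).support)
    (hq : q ∈ (Matrix.det (∑ l, ((X : ℝ[X]) ^ d l) • (S l).map C)).support)
    (hr : r ∈ (Matrix.det (∑ l, ((X : ℝ[X]) ^ d l) • (S l).map C)).support)
    (hqp : q < p) (hrq : r < q) (hH : H ⊆ (Matrix.det (∑ l, ((X : ℝ[X]) ^ d l) • (S l).map C)).support)
    (hHp : ∀ h ∈ H, p < h) (U : Finset ℕ)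
    (hU : U = ((((Matrix.det (∑ l, ((X : ℝ[X]) ^ d l) • (S l).map C)).support \ H).erase p).erase q).erase r)
    (Cf : ℕ → ℝ)
    (hCf : ∀ s, Cf s = (Matrix.det (∑ l, ((X : ℝ[X]) ^ d l) • (S l).map C)).coeff s * ∏ u ∈ U, ((u : ℝ) - s))
    (hspq : Cf p * Cf q < 0) (hsqr : Cf q * Cf r < 0)
    (w : ℕ → ℝ) (hw0 : ∀ h ∈ H, 0 ≤ w h) (hw1 : ∑ h ∈ H, w h ≤ 1)
    (hwl : ∀ h ∈ H, |Cf h| ^ (q - r) * ((((p : ℝ) - r)) * |Cf r| * ∏ i ∈ H, ((i : ℝ) - r)) ^ (h - p)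
        ≤ (w h) ^ (q - r) * |Cf p| ^ (q - r) * ((((p : ℝ) - q)) * |Cf q| * ∏ i ∈ H, ((i : ℝ) - q)) ^ (h - p)) :
    (((p : ℝ) - r)) ^ (p - r) * ((1 - ∑ h ∈ H, w h) * |Cf p|) ^ (q - r) * |Cf r| ^ (p - q)
      ≤ |Cf q| ^ (p - r) * (((p : ℝ) - q)) ^ (p - q) * (((q : ℝ) - r)) ^ (q - r) :=
  end_window_coeff_rev _ ((Finset.card_le_card (support_det_pencil_subset_sumset d S)).trans hZ) H hp hq hr hqp hrq
    hH hHp U hU Cf hCf hspq hsqr w hw0 hw1 hwl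

end Summit.ValiantsHypothesis.ValiantsHypothesis.Theorems.LacunarySymmetroidMatrixDescartes.Census
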